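import Summits.ABC.IUTFork.Repair.RHHeightScaling
import Summits.ABC.IUTFork.Repair.RHHeightScalingSRM
import HarnessLib

/-!
# R-H ROUND 4, R4-6 (ii) object class «MULTIL» (MULTI-PRIME PACKETS — several admissible primes `l` for ONE curve datum): pooling
# finitely many price-bounded packets is price-bounded (exponent `−1`, constant = the mass-weighted MEDIANT of the per-`l` constants);
# a growing `l`-universe changes nothing for the pooled reading; the only `DoorAt` is CROSS-`l` pooling of a packet COUNT that outgrows
# ONE packet's bill — and that door is the count, not a class law

abc-iut cell, rung LADDER-ABC:A2.RESCUE.H; seat abc-iut-rh2-q2-eq (gen 9), KEY `wake/KEY-abc-iut-rh2-q2-eq-R4OBJ-MULTIL.md` (abc-iut-rh-lead g5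
2026-08-27T13:46:57Z; HUMAN D-0133 · D-0134 · D-0135: round-4 EXPONENT HUNT for object classes outside the six typed classes of AXIS D2; this
class = (ii) «packets using several admissible primes l at once for the same curve datum», census row O-07; file of record
`plan/rescue/R-H/ROUND4/R4-6-MULTIL-rh2-q2-eq.md`). Vocabulary of record: abc-iut-rh2-T-1 `RHHeightScaling` (p532994) — `ExponentAtMost`,
`NegExponent`, `DoorAt`, `PriceBounded`, `negExponent_of_priceBounded`, `not_doorAt_of_negExponent`; per-`l` packet bracket: this seat's
`RHHeightScalingSRM` (p532290) `srm_le` / `le_srm_of_saturated` (AXIS-D2 row 2: SRM/EX class, exponent `−1`, constant `ĉ_l = Π₂(l)/M(l)`).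

THE OBJECT IN CELL CURRENCY (memo §1). A curve datum `C` read `l`-free at its bad places `(p_v, e_v, n_v, c_v)`; at an admissible prime `l`
the packet is the single-`l` cell family of record (`e_w = e_v·l`, `m_q = n_v/2`, `δ_w = c_v·l − 1`, `R_in = ⌊e_w/(p−1)⌋+1`, `R_out = min_t(p^t − t·e_w)`,
labels `j ≤ l⋆`), unit weights `u_{v,l} = ln p_v/(l⋆·e_w)` (print's scheme AT THAT `l`), mass `M_l(s) = s·M_l(1)` (`M_l(1) = k_l·h_C`, `k_l =
(l−3)(l+4)/(24l)`), kept mass `K_l(s) ≤ Π_l⁺` at every `s` and `∈ [Π_l⁻, Π_l⁺]` past saturation. For a finite set `Λ` of primes and `s`-free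
weights `ν_l ≥ 0` the combined readings are (R1) the `ν`-MEAN OF FRACTIONS `Σ ν_l·K_l(s)/(s·M_l(1))` and (R2) the POOLED fraction
`(Σ ν_l K_l(s)) / (s·Σ ν_l M_l(1))` (a positive combination of per-`l` Statements: closing ⟹ some single `l` closes); (R3×) CROSS-`l` POOLING
credits every packet's kept mass against ONE packet's bill `s·M_{l₀}(1)` — not a consequence of per-`l` Statements (it needs a cross-`l`
transfer law, residual R-07×; in print `l` is part of the initial Θ-data, [IUTchI] Def. 3.1, and [IUTchIV] Cor. 2.2 (ii) chooses ONE `l`).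

WHAT IS PROVED (namespace `Summit.ABC.IUTFork.Repair.RH.HeightScalingMultiL`; PROOF-ONLY, no `def`, no instance, no notation; reals over
an arbitrary finite index set — the hypotheses are exactly the per-`l` certificates the SRM/EX faces supply):
* §1 (R2) POOLING IS PRICE-BOUNDED: `sum_kept_le_sum_cap`; **`priceBounded_pool`** (kept `K_l(s) ≤ P_l` for `s ≥ 1`, `ν ≥ 0` ⇒ the pooled
  profile is `PriceBounded (Σ ν_l M_l)`); **`negExponent_pool`**, **`not_doorAt_pool`** (pooled mass `> 0`) — BY NAME over p532994.
* §2 THE MEDIANT LAW (the constant re-averages, the exponent does not move): `sum_cap_le_mul_sum_mass` (`P_l ≤ C·M_l` ⇒ `Σ νP ≤ C·Σ νM`),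
  **`pool_le_div`** (`⇒ pooled(s) ≤ C/s` for every `s ≥ 1`), **`exponentAtMost_pool`** (`ExponentAtMost pooled (−1) C` — `C = max_l ĉ_l⁺`),
  and the lower side **`div_le_pool_of_floor`** (`c·M_l ≤ A_l ≤ K_l(s)` for `s ≥ s₀` ⇒ `c/s ≤ pooled(s)` for `s ≥ max(1,s₀)` — `c = min_l ĉ_l⁻`):
  exponent EXACTLY `−1`, two-sided, constant in `[min_l ĉ_l⁻, max_l ĉ_l⁺]`.
* §3 (R1) MEAN OF FRACTIONS: **`mean_le_div`**, **`exponentAtMost_mean`** (`f_l(s) ≤ c_l/s`, `c_l ≤ C`, `Σ ν = 1` ⇒ mean `≤ C/s`).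
* §4 GROWING UNIVERSE: **`pool_le_div_family`** / **`exponentAtMost_pool_family`** — for an `s`-DEPENDENT family of finite index sets `Λ(s)`
  with the uniform cap `P_l ≤ C·M_l` the pooled reading is still `≤ C/s`: letting the admissible-`l` universe grow with the height (print's
  (P1) window `√h ≤ l ≤ 10δ√h·ln(2δh)`) changes NOTHING for (R1)/(R2) as long as the per-`l` constants are uniformly capped (memo §2(b): the
  cap carries at most one logarithm of `l` from the log-shell span; `NegExponent` unaffected).
* §5 (R3×) THE ONLY DOOR IS A COUNT: **`doorAt_crossPool_of_count`** — if every pooled packet keeps at least `π₀ > 0` and the NUMBER of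
  packets credited against the fixed bill `s·M₀` satisfies `N(s) ≥ s`, the cross-pooled profile is a `DoorAt` (constant `π₀/M₀`);
  **`crossPool_le_count_div`** — conversely it is `≤ N(s)·Π̄/(s·M₀)`: its exponent is the COUNT's exponent minus one, never a property of a
  packet; and **`crossPool_own_bill_le_div`** — the same `N(s)` packets pooled against THEIR OWN bills `Σ_{i<N(s)} s·M_i` are back to `≤ C/s`
  (§4): the «door» is exactly the unpaid-bill ratio `Σ_{i<N(s)} M_i / M₀` (memo §2(c): on the (P1) window with a fixed target prime that ratio
  is `≍ s·ln s` — `≈ 10⁷` packets against one bill already at the bed height).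
* §6 BED ROWS by `decide` (R-W WINDOW-TABLE integers, kit-2 PASS 20 PROFILE 134302633c4fb278): the HEX `λ₈` K-line place `p = 7` at TWO primes
  — `l = 11` (`e 165, m_q 120, δ 164, R_in 28, R_out −281, L 5`; p532290 §4) and `l = 13` (`e 195, m_q 120, δ 194, R_in 33, R_out −341, L 6`;
  the `l`-free recipe `e = 15·l`, `δ = 15·l − 1`, `R_in = ⌊e/6⌋+1`, `R_out = min_t(7^t − t·e)` reproduces both rows): at `s = 100` (`m = 12000`)
  `SRM₁₁ = 8238 / MASS 600000`, `SRM₁₃ = 13685 / MASS 1020000` (both saturated, brackets `[7858, 8514]` and `[13230, 14200]`), and the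
  two-prime POOLED fraction with the unit weights `1/(L·e)` (the common `ln 7` cancels) `= 1395239/102900000 = 0.013559…` lies BETWEEN
  `13685/1020000 = 0.013417` and `8238/600000 = 0.013730` (mediant), while the CROSS-pooled one against the `l = 11` bill is `×U`, `U =
  (Σ weighted masses)/(l = 11 mass) = 343/156 = 2.1987…` — a packet count, height-free.
HONEST FRAMING: real bookkeeping over named hypotheses + integer arithmetic of prescribed table columns; the per-`l` certificates
(`K_l ≤ Π_l⁺`, saturation floors) are the SRM/EX faces' theorems, instantiated per packet by the kit tables (computed ≠ proved at genuine
data); height scaling `m_q ↦ s·m_q` is the WINDOW MODEL of D-0121 FINAL (1)(e) (R78), not an operation on genuine data; «MULTIL», (R1)/(R2)/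
(R3×) and the cross-`l` transfer law are claim-tagged readings in OUR typed cell currency, never Literature facts; nothing here asserts that
abc is proved or refuted, decides [IUTchIII] Cor. 3.12 / [IUTchIV] Thm 1.10 / Cor. 2.2 at any datum, or takes a side on any author
(Mochizuki / Scholze–Stix / Joshi / Dupuy–Hilado); typed ≠ proved for anything not named as a theorem. [claim: Mochizuki2012, status:
disputed] for every IUT locution. [cite: Mochizuki2012, IUTchI Def. 3.1; IUTchIV Prop. 1.2 p. 10, Thm. 1.10 p. 21, Cor. 2.2 (ii) p. 34]
-/

namespace Summit.ABC.IUTFork.Repair.RH.HeightScalingMultiL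

open Finset Summit.ABC.IUTFork.Repair.RH.HeightScaling

variable {ι : Type*}

/-! ## §1. (R2) Pooling finitely many price-bounded packets is price-bounded -/

/-- The pooled certificate is capped by the pooled caps: `K_l(s) ≤ P_l` for `s ≥ 1` and `ν_l ≥ 0` on `Λ` ⇒
`Σ_Λ ν_l·K_l(s) ≤ Σ_Λ ν_l·P_l`. [folklore] -/
theorem sum_kept_le_sum_cap (Λ : Finset ι) (ν P : ι → ℝ) (K : ι → ℝ → ℝ) (hν : ∀ l ∈ Λ, 0 ≤ ν l)
    (hK : ∀ l ∈ Λ, ∀ s : ℝ, 1 ≤ s → K l s ≤ P l) {s : ℝ} (hs : 1 ≤ s) :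
    ∑ l ∈ Λ, ν l * K l s ≤ ∑ l ∈ Λ, ν l * P l :=
  sum_le_sum fun l hl => mul_le_mul_of_nonneg_left (hK l hl s hs) (hν l hl)

/-- **(R2) POOLING IS PRICE-BOUNDED.** If every packet `l ∈ Λ` keeps at most its height-free cap (`K_l(s) ≤ P_l` for all `s ≥ 1`) and the
`l`-weights are `ν_l ≥ 0`, the POOLED recovered fraction `s ↦ (Σ ν_l K_l(s)) / (s·Σ ν_l M_l)` is `PriceBounded` over the pooled mass
`Σ ν_l M_l` (certificate `Σ ν_l K_l`, cap `Σ ν_l P_l`). [folklore] -/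
theorem priceBounded_pool (Λ : Finset ι) (ν P M : ι → ℝ) (K : ι → ℝ → ℝ) (hν : ∀ l ∈ Λ, 0 ≤ ν l)
    (hK : ∀ l ∈ Λ, ∀ s : ℝ, 1 ≤ s → K l s ≤ P l) :
    PriceBounded (∑ l ∈ Λ, ν l * M l) (fun s => (∑ l ∈ Λ, ν l * K l s) / (s * ∑ l ∈ Λ, ν l * M l)) :=
  ⟨fun s => ∑ l ∈ Λ, ν l * K l s, ∑ l ∈ Λ, ν l * P l, fun _ hs => sum_kept_le_sum_cap Λ ν P K hν hK hs, fun _ _ => rfl⟩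

/-- **The pooled multi-`l` profile has a negative exponent** (pooled mass `> 0`) — `negExponent_of_priceBounded` BY NAME. [folklore] -/
theorem negExponent_pool (Λ : Finset ι) (ν P M : ι → ℝ) (K : ι → ℝ → ℝ) (hν : ∀ l ∈ Λ, 0 ≤ ν l)
    (hK : ∀ l ∈ Λ, ∀ s : ℝ, 1 ≤ s → K l s ≤ P l) (hM : 0 < ∑ l ∈ Λ, ν l * M l) :
    NegExponent (fun s => (∑ l ∈ Λ, ν l * K l s) / (s * ∑ l ∈ Λ, ν l * M l)) :=
  negExponent_of_priceBounded hM (priceBounded_pool Λ ν P M K hν hK)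

/-- **No finite multi-`l` pooling is a door** — `not_doorAt_of_negExponent` BY NAME. [folklore] -/
theorem not_doorAt_pool (Λ : Finset ι) (ν P M : ι → ℝ) (K : ι → ℝ → ℝ) (hν : ∀ l ∈ Λ, 0 ≤ ν l)
    (hK : ∀ l ∈ Λ, ∀ s : ℝ, 1 ≤ s → K l s ≤ P l) (hM : 0 < ∑ l ∈ Λ, ν l * M l) :
    ¬ DoorAt (fun s => (∑ l ∈ Λ, ν l * K l s) / (s * ∑ l ∈ Λ, ν l * M l)) :=
  not_doorAt_of_negExponent (negExponent_pool Λ ν P M K hν hK hM)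

/-! ## §2. The mediant law: the constant re-averages inside `[min_l ĉ_l⁻, max_l ĉ_l⁺]`, the exponent stays `−1` -/

/-- Uniform per-packet constant ⇒ pooled cap: `P_l ≤ C·M_l` and `ν_l ≥ 0` on `Λ` ⇒ `Σ ν_l P_l ≤ C·Σ ν_l M_l`. [folklore] -/
theorem sum_cap_le_mul_sum_mass (Λ : Finset ι) (ν P M : ι → ℝ) (C : ℝ) (hν : ∀ l ∈ Λ, 0 ≤ ν l)
    (hP : ∀ l ∈ Λ, P l ≤ C * M l) : ∑ l ∈ Λ, ν l * P l ≤ C * ∑ l ∈ Λ, ν l * M l := by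
  rw [mul_sum]
  exact sum_le_sum fun l hl => by
    have := mul_le_mul_of_nonneg_left (hP l hl) (hν l hl)
    linarith [mul_left_comm (ν l) C (M l)]

/-- Uniform per-packet floor ⇒ pooled floor: `c·M_l ≤ A_l` and `ν_l ≥ 0` on `Λ` ⇒ `c·Σ ν_l M_l ≤ Σ ν_l A_l`. [folklore] -/
theorem mul_sum_mass_le_sum_floor (Λ : Finset ι) (ν A M : ι → ℝ) (c : ℝ) (hν : ∀ l ∈ Λ, 0 ≤ ν l)
    (hA : ∀ l ∈ Λ, c * M l ≤ A l) : c * ∑ l ∈ Λ, ν l * M l ≤ ∑ l ∈ Λ, ν l * A l := by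
  rw [mul_sum]
  exact sum_le_sum fun l hl => by
    have := mul_le_mul_of_nonneg_left (hA l hl) (hν l hl)
    linarith [mul_left_comm (ν l) c (M l)]

/-- **(R2) THE POOLED PROFILE IS `≤ (max constant)/s` AT EVERY HEIGHT.** Per packet `K_l(s) ≤ P_l ≤ C·M_l` (`C = max_l ĉ_l⁺`), `ν ≥ 0`,
pooled mass `> 0` ⇒ `(Σ ν_l K_l(s))/(s·Σ ν_l M_l) ≤ C/s` for every `s ≥ 1`. Combining primes re-averages the constant; it cannot beat the
largest single-`l` constant. [folklore] -/
theorem pool_le_div (Λ : Finset ι) (ν P M : ι → ℝ) (K : ι → ℝ → ℝ) (C : ℝ) (hν : ∀ l ∈ Λ, 0 ≤ ν l)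
    (hK : ∀ l ∈ Λ, ∀ s : ℝ, 1 ≤ s → K l s ≤ P l) (hP : ∀ l ∈ Λ, P l ≤ C * M l) (hM : 0 < ∑ l ∈ Λ, ν l * M l)
    {s : ℝ} (hs : 1 ≤ s) :
    (∑ l ∈ Λ, ν l * K l s) / (s * ∑ l ∈ Λ, ν l * M l) ≤ C / s := by
  have hs0 : 0 < s := by linarith
  rw [div_le_div_iff₀ (by positivity) hs0]
  have h1 := sum_kept_le_sum_cap Λ ν P K hν hK hs
  have h2 := sum_cap_le_mul_sum_mass Λ ν P M C hν hP
  have h3 : (∑ l ∈ Λ, ν l * K l s) * s ≤ (C * ∑ l ∈ Λ, ν l * M l) * s :=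
    mul_le_mul_of_nonneg_right (h1.trans h2) hs0.le
  linarith

/-- **(R2) EXPONENT `−1` WITH CONSTANT `C = max_l ĉ_l⁺`** for every finite multi-`l` pooling. [folklore] -/
theorem exponentAtMost_pool (Λ : Finset ι) (ν P M : ι → ℝ) (K : ι → ℝ → ℝ) (C : ℝ) (hν : ∀ l ∈ Λ, 0 ≤ ν l)
    (hK : ∀ l ∈ Λ, ∀ s : ℝ, 1 ≤ s → K l s ≤ P l) (hP : ∀ l ∈ Λ, P l ≤ C * M l) (hM : 0 < ∑ l ∈ Λ, ν l * M l) :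
    ExponentAtMost (fun s => (∑ l ∈ Λ, ν l * K l s) / (s * ∑ l ∈ Λ, ν l * M l)) (-1) C :=
  exponentAtMost_neg_one_of_le_div fun _ hs => pool_le_div Λ ν P M K C hν hK hP hM hs

/-- **(R2) LOWER SIDE PAST SATURATION: `(min constant)/s ≤ pooled`.** Per packet a saturation floor `A_l ≤ K_l(s)` for `s ≥ s₀` with
`c·M_l ≤ A_l` (`c = min_l ĉ_l⁻`), `ν ≥ 0`, pooled mass `> 0` ⇒ `c/s ≤ (Σ ν_l K_l(s))/(s·Σ ν_l M_l)` for every `s ≥ max(1, s₀)`. With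
`pool_le_div`: exponent EXACTLY `−1`, two-sided, constant in `[min_l ĉ_l⁻, max_l ĉ_l⁺]` — the mediant law. [folklore] -/
theorem div_le_pool_of_floor (Λ : Finset ι) (ν A M : ι → ℝ) (K : ι → ℝ → ℝ) (c s₀ : ℝ) (hν : ∀ l ∈ Λ, 0 ≤ ν l)
    (hA : ∀ l ∈ Λ, ∀ s : ℝ, s₀ ≤ s → A l ≤ K l s) (hc : ∀ l ∈ Λ, c * M l ≤ A l) (hM : 0 < ∑ l ∈ Λ, ν l * M l)
    {s : ℝ} (hs : 1 ≤ s) (hs₀ : s₀ ≤ s) :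
    c / s ≤ (∑ l ∈ Λ, ν l * K l s) / (s * ∑ l ∈ Λ, ν l * M l) := by
  have hs0 : 0 < s := by linarith
  rw [div_le_div_iff₀ hs0 (by positivity)]
  have h1 : ∑ l ∈ Λ, ν l * A l ≤ ∑ l ∈ Λ, ν l * K l s :=
    sum_le_sum fun l hl => mul_le_mul_of_nonneg_left (hA l hl s hs₀) (hν l hl)
  have h2 := mul_sum_mass_le_sum_floor Λ ν A M c hν hc
  have h3 : (c * ∑ l ∈ Λ, ν l * M l) * s ≤ (∑ l ∈ Λ, ν l * K l s) * s :=
    mul_le_mul_of_nonneg_right (h2.trans h1) hs0.le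
  linarith

/-! ## §3. (R1) The mean of the per-`l` fractions -/

/-- **(R1) MEAN OF FRACTIONS `≤ (max constant)/s`.** Per packet `f_l(s) ≤ c_l/s` for `s ≥ 1` with `c_l ≤ C`, weights `ν_l ≥ 0` summing to
`1` ⇒ `Σ ν_l f_l(s) ≤ C/s`. [folklore] -/
theorem mean_le_div (Λ : Finset ι) (ν c : ι → ℝ) (f : ι → ℝ → ℝ) (C : ℝ) (hν : ∀ l ∈ Λ, 0 ≤ ν l) (hsum : ∑ l ∈ Λ, ν l = 1)
    (hf : ∀ l ∈ Λ, ∀ s : ℝ, 1 ≤ s → f l s ≤ c l / s) (hc : ∀ l ∈ Λ, c l ≤ C) {s : ℝ} (hs : 1 ≤ s) :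
    ∑ l ∈ Λ, ν l * f l s ≤ C / s := by
  have hs0 : 0 < s := by linarith
  calc ∑ l ∈ Λ, ν l * f l s ≤ ∑ l ∈ Λ, ν l * (C / s) :=
        sum_le_sum fun l hl => mul_le_mul_of_nonneg_left
          ((hf l hl s hs).trans (div_le_div_of_nonneg_right (hc l hl) hs0.le)) (hν l hl)
    _ = C / s := by rw [← sum_mul, hsum, one_mul]

/-- **(R1) EXPONENT `−1` WITH CONSTANT `C = max_l c_l`** for the `ν`-mean of the per-`l` recovered fractions. [folklore] -/
theorem exponentAtMost_mean (Λ : Finset ι) (ν c : ι → ℝ) (f : ι → ℝ → ℝ) (C : ℝ) (hν : ∀ l ∈ Λ, 0 ≤ ν l) (hsum : ∑ l ∈ Λ, ν l = 1)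
    (hf : ∀ l ∈ Λ, ∀ s : ℝ, 1 ≤ s → f l s ≤ c l / s) (hc : ∀ l ∈ Λ, c l ≤ C) :
    ExponentAtMost (fun s => ∑ l ∈ Λ, ν l * f l s) (-1) C :=
  exponentAtMost_neg_one_of_le_div fun _ hs => mean_le_div Λ ν c f C hν hsum hf hc hs

/-! ## §4. A growing `l`-universe changes nothing for the pooled reading -/

/-- **(R2) OVER AN `s`-DEPENDENT FAMILY OF FINITE PRIME SETS.** If EVERY packet of the universe obeys `K_l(s) ≤ P_l ≤ C·M_l` (`s ≥ 1`) with
`ν ≥ 0`, then for any family `Λ(s)` of finite sets with positive pooled mass the pooled profile over `Λ(s)` is `≤ C/s` at every `s ≥ 1`: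
the admissible-`l` universe may grow with the height (print's (P1) window) — reading (R2) keeps exponent `−1` with the uniform constant. [folklore] -/
theorem pool_le_div_family (Λ : ℝ → Finset ι) (ν P M : ι → ℝ) (K : ι → ℝ → ℝ) (C : ℝ) (hν : ∀ l, 0 ≤ ν l)
    (hK : ∀ l, ∀ s : ℝ, 1 ≤ s → K l s ≤ P l) (hP : ∀ l, P l ≤ C * M l) (hM : ∀ s : ℝ, 1 ≤ s → 0 < ∑ l ∈ Λ s, ν l * M l)
    {s : ℝ} (hs : 1 ≤ s) :
    (∑ l ∈ Λ s, ν l * K l s) / (s * ∑ l ∈ Λ s, ν l * M l) ≤ C / s :=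
  pool_le_div (Λ s) ν P M K C (fun l _ => hν l) (fun l _ => hK l) (fun l _ => hP l) (hM s hs) hs

/-- The same as an `ExponentAtMost (−1) C` statement for the family profile `s ↦ pooled over Λ(s)`. [folklore] -/
theorem exponentAtMost_pool_family (Λ : ℝ → Finset ι) (ν P M : ι → ℝ) (K : ι → ℝ → ℝ) (C : ℝ) (hν : ∀ l, 0 ≤ ν l)
    (hK : ∀ l, ∀ s : ℝ, 1 ≤ s → K l s ≤ P l) (hP : ∀ l, P l ≤ C * M l) (hM : ∀ s : ℝ, 1 ≤ s → 0 < ∑ l ∈ Λ s, ν l * M l) :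
    ExponentAtMost (fun s => (∑ l ∈ Λ s, ν l * K l s) / (s * ∑ l ∈ Λ s, ν l * M l)) (-1) C :=
  exponentAtMost_neg_one_of_le_div fun _ hs => pool_le_div_family Λ ν P M K C hν hK hP hM hs

/-! ## §5. (R3×) Cross-`l` pooling against ONE bill: the door is a packet count -/

/-- **(R3×) A DOOR BY COUNT.** If each pooled packet `i` keeps at least `π₀ > 0` at every height `s ≥ 1` and the NUMBER `N(s)` of packets
credited against the FIXED bill `s·M₀` (`M₀ > 0`) satisfies `s ≤ N(s)`, then the cross-pooled profile `s ↦ (Σ_{i<N(s)} K_i(s))/(s·M₀)` is a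
`DoorAt` with constant `π₀/M₀`. The hypothesis that does the work is the COUNT growing with the height against one bill — a cross-`l`
transfer assumption (residual R-07×), not a property of any packet. [folklore] -/
theorem doorAt_crossPool_of_count (K : ℕ → ℝ → ℝ) (N : ℝ → ℕ) (π₀ M₀ : ℝ) (hπ : 0 < π₀) (hM : 0 < M₀)
    (hK : ∀ i : ℕ, ∀ s : ℝ, 1 ≤ s → π₀ ≤ K i s) (hN : ∀ s : ℝ, 1 ≤ s → s ≤ (N s : ℝ)) :
    DoorAt (fun s => (∑ i ∈ range (N s), K i s) / (s * M₀)) := by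
  refine doorAt_of_const_le (div_pos hπ hM) fun s hs => ?_
  have hs0 : 0 < s := by linarith
  rw [div_le_div_iff₀ hM (by positivity)]
  have h1 : (N s : ℝ) * π₀ ≤ ∑ i ∈ range (N s), K i s := by
    have h := sum_le_sum (s := range (N s)) (f := fun _ => π₀) (g := fun i => K i s) fun i _ => hK i s hs
    rwa [sum_const, card_range, nsmul_eq_mul] at h
  have h2 : s * π₀ ≤ (N s : ℝ) * π₀ := mul_le_mul_of_nonneg_right (hN s hs) hπ.le
  nlinarith

/-- **(R3×) THE CROSS-POOLED PROFILE IS AT MOST `COUNT × cap / bill`.** With per-packet caps `K_i(s) ≤ Π̄` (`s ≥ 1`):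
`(Σ_{i<N(s)} K_i(s))/(s·M₀) ≤ N(s)·Π̄/(s·M₀)` (`M₀ > 0`) — the exponent of (R3×) is the exponent of the count `N(s)` minus one; for a FIXED
finite packet set it is `−1` like every single packet. [folklore] -/
theorem crossPool_le_count_div (K : ℕ → ℝ → ℝ) (N : ℝ → ℕ) (Pbar M₀ : ℝ) (hM : 0 < M₀)
    (hK : ∀ i : ℕ, ∀ s : ℝ, 1 ≤ s → K i s ≤ Pbar) {s : ℝ} (hs : 1 ≤ s) :
    (∑ i ∈ range (N s), K i s) / (s * M₀) ≤ (N s : ℝ) * Pbar / (s * M₀) := by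
  have hs0 : 0 < s := by linarith
  apply div_le_div_of_nonneg_right _ (by positivity)
  have h := sum_le_sum (s := range (N s)) (f := fun i => K i s) (g := fun _ => Pbar) fun i _ => hK i s hs
  rwa [sum_const, card_range, nsmul_eq_mul] at h

/-- **(R3×) THE SAME PACKETS AGAINST THEIR OWN BILLS ARE BACK TO `≤ C/s`.** If the `N(s)` pooled packets obey `K_i(s) ≤ P_i ≤ C·M_i` and their
own pooled bill `Σ_{i<N(s)} M_i` is positive, then `(Σ_{i<N(s)} K_i(s))/(s·Σ_{i<N(s)} M_i) ≤ C/s` for every `s ≥ 1` (§4 with `Λ(s) = {i < N(s)}`,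
`ν ≡ 1`): the (R3×) «door» is exactly the unpaid-bill ratio `(Σ_{i<N(s)} M_i)/M₀`, an accounting choice, not a height law. [folklore] -/
theorem crossPool_own_bill_le_div (K : ℕ → ℝ → ℝ) (N : ℝ → ℕ) (P M : ℕ → ℝ) (C : ℝ)
    (hK : ∀ i : ℕ, ∀ s : ℝ, 1 ≤ s → K i s ≤ P i) (hP : ∀ i, P i ≤ C * M i) (hM : ∀ s : ℝ, 1 ≤ s → 0 < ∑ i ∈ range (N s), M i)
    {s : ℝ} (hs : 1 ≤ s) :
    (∑ i ∈ range (N s), K i s) / (s * ∑ i ∈ range (N s), M i) ≤ C / s := by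
  have h := pool_le_div_family (fun s => range (N s)) (fun _ => (1 : ℝ)) P M K C (fun _ => zero_le_one) hK hP
    (fun s hs => by simpa only [one_mul] using hM s hs) hs
  simpa only [one_mul] using h

/-! ## §6. Bed rows: the HEX `λ₈` K-line place `p = 7` at the two primes `l = 11` and `l = 13` -/

/-- `l = 13` packet of `λ₈` at `p = 7` (`e = 195 = 15·13`, `m_q = 120`, `δ = 194 = 15·13 − 1`, `R_in = 33 = ⌊195/6⌋ + 1`, `R_out = −341 = 7² − 2·195`,
`L = 6`): AT THE BED (`m = 120`) `SRM = 3782 / MASS 10200`; at `s = 100` (`m = 12000`, saturated: `2δ + 3G + e = 1705 ≤ 36000`)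
`SRM = 13685 ∈ [13230, 14200] / MASS 1020000`. [folklore] -/
example :
    (∑ k ∈ Finset.range (5 + 1),
        (if 0 < (195 : ℤ) * ((((k : ℤ) + 1) ^ 2 * 120 - ((k : ℤ) + 1) * 194 - ((k : ℤ) + 1 + 1) * 33) / 195) + ((k : ℤ) + 1 + 1) * (-341) - 120 then
          (((k : ℤ) + 1) ^ 2 - 1) * 120 -
            ((195 : ℤ) * ((((k : ℤ) + 1) ^ 2 * 120 - ((k : ℤ) + 1) * 194 - ((k : ℤ) + 1 + 1) * 33) / 195) + ((k : ℤ) + 1 + 1) * (-341) - 120)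
        else 0)) = 3782 ∧
    (∑ k ∈ Finset.range (5 + 1), ((((k : ℤ) + 1) ^ 2 - 1) * (120 : ℤ))) = 10200 ∧
    (∑ k ∈ Finset.range (5 + 1),
        (if 0 < (195 : ℤ) * ((((k : ℤ) + 1) ^ 2 * 12000 - ((k : ℤ) + 1) * 194 - ((k : ℤ) + 1 + 1) * 33) / 195) + ((k : ℤ) + 1 + 1) * (-341) - 12000 then
          (((k : ℤ) + 1) ^ 2 - 1) * 12000 -
            ((195 : ℤ) * ((((k : ℤ) + 1) ^ 2 * 12000 - ((k : ℤ) + 1) * 194 - ((k : ℤ) + 1 + 1) * 33) / 195) + ((k : ℤ) + 1 + 1) * (-341) - 12000)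
        else 0)) = 13685 ∧
    (∑ k ∈ Finset.range (5 + 1), ((((k : ℤ) + 1) ^ 2 - 1) * (12000 : ℤ))) = 1020000 ∧
    2 * (194 : ℤ) + 3 * (33 - (-341)) + 195 = 1705 ∧
    3 * (5 : ℤ) * (5 + 3) * 194 + 3 * 5 * (5 + 5) * (33 - (-341)) = 6 * 13230 ∧
    3 * (5 : ℤ) * (5 + 3) * 194 + 3 * 5 * (5 + 5) * (33 - (-341)) + 6 * 5 * (195 - 1) = 6 * 14200 := by
  decide

/-- The `l = 13` saturated band as an instance of this seat's general theorems (p532290, `n = 5`, `m = 12000`):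
`6·13230 ≤ 6·SRM₁₃(12000) ≤ 6·14200`. [folklore] -/
example :
    3 * ((5 : ℕ) : ℤ) * ((5 : ℕ) + 3) * 194 + 3 * ((5 : ℕ) : ℤ) * ((5 : ℕ) + 5) * (33 - (-341)) ≤
      6 * ∑ k ∈ Finset.range (5 + 1),
        (if 0 < (195 : ℤ) * ((((k : ℤ) + 1) ^ 2 * 12000 - ((k : ℤ) + 1) * 194 - ((k : ℤ) + 1 + 1) * 33) / 195) + ((k : ℤ) + 1 + 1) * (-341) - 12000 then
          (((k : ℤ) + 1) ^ 2 - 1) * 12000 -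
            ((195 : ℤ) * ((((k : ℤ) + 1) ^ 2 * 12000 - ((k : ℤ) + 1) * 194 - ((k : ℤ) + 1 + 1) * 33) / 195) + ((k : ℤ) + 1 + 1) * (-341) - 12000)
        else 0) ∧
    6 * ∑ k ∈ Finset.range (5 + 1),
        (if 0 < (195 : ℤ) * ((((k : ℤ) + 1) ^ 2 * 12000 - ((k : ℤ) + 1) * 194 - ((k : ℤ) + 1 + 1) * 33) / 195) + ((k : ℤ) + 1 + 1) * (-341) - 12000 then
          (((k : ℤ) + 1) ^ 2 - 1) * 12000 -
            ((195 : ℤ) * ((((k : ℤ) + 1) ^ 2 * 12000 - ((k : ℤ) + 1) * 194 - ((k : ℤ) + 1 + 1) * 33) / 195) + ((k : ℤ) + 1 + 1) * (-341) - 12000)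
        else 0)
      ≤ 3 * ((5 : ℕ) : ℤ) * ((5 : ℕ) + 3) * 194 + 3 * ((5 : ℕ) : ℤ) * ((5 : ℕ) + 5) * (33 - (-341)) + 6 * ((5 : ℕ) : ℤ) * (195 - 1) :=
  ⟨HeightScalingSRM.le_srm_of_saturated 12000 195 194 33 (-341) (by norm_num) (by norm_num) (by norm_num) (by norm_num) 5,
   HeightScalingSRM.srm_le 12000 195 194 33 (-341) (by norm_num) (by norm_num) (by norm_num) 5⟩

/-- **TWO-PRIME POOLING OF `λ₈` AT `p = 7`, `s = 100`** (p532290 §4: `SRM₁₁ = 8238 / MASS 600000`; above: `SRM₁₃ = 13685 / MASS 1020000`; unit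
weights `1/(L·e)` = `1/(5·165)` and `1/(6·195)`, the common `ln 7` cancels): the POOLED fraction (reading (R2)) is the mediant
`(6·195·8238 + 5·165·13685)/(6·195·600000 + 5·165·1020000) = 1395239/102900000 ≈ 0.013559`, strictly between the single-prime fractions
`13685/1020000 ≈ 0.013417 (l = 13)` and `8238/600000 = 0.013730 (l = 11)`; the MEAN of fractions (reading (R1), `ν = ½`) is between them too;
the CROSS-pooled fraction against the `l = 11` bill alone (reading (R3×)) is the pooled one times the unpaid-bill ratio
`U = (6·195·600000 + 5·165·1020000)/(6·195·600000) = 343/156 ≈ 2.1987` — a packet count, height-free. [folklore] -/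
example :
    ((6 * 195 * 8238 + 5 * 165 * 13685 : ℚ) / (6 * 195 * 600000 + 5 * 165 * 1020000) = 1395239 / 102900000) ∧
    ((13685 : ℚ) / 1020000 < 1395239 / 102900000) ∧ ((1395239 : ℚ) / 102900000 < 8238 / 600000) ∧
    ((13685 : ℚ) / 1020000 < (8238 / 600000 + 13685 / 1020000) / 2) ∧ (((8238 : ℚ) / 600000 + 13685 / 1020000) / 2 < 8238 / 600000) ∧
    ((6 * 195 * 8238 + 5 * 165 * 13685 : ℚ) / (6 * 195 * 600000) = (1395239 / 102900000) * (343 / 156)) ∧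
    ((6 * 195 * 600000 + 5 * 165 * 1020000 : ℚ) / (6 * 195 * 600000) = 343 / 156) := by
  norm_num

end Summit.ABC.IUTFork.Repair.RH.HeightScalingMultiL
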